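import Literature.Computability.Complexity.TableauRows
import Literature.Computability.Complexity.PrefixFunctions
import Literature.Computability.Complexity.KarpLipton
import Literature.Computability.Complexity.StackBricksStrings
import Literature.Computability.Complexity.FoldBricks
import HarnessLib

/-!
# Meyer's theorem, the `Σ₂ᵖ` verifier I: queries to the advice, the claimed rows, the blocks

Second file of the proof of **Meyer's theorem** `EXP ⊆ P/poly ⟹ EXP = Σ₂ᵖ` (Karp–Lipton 1980,
§6, attributed to A. Meyer; Arora–Barak 2009, Thm. 6.20) over the tree's classes; see
`TableauRows.lean` for the plan. Arora–Barak's `Σ₂ᵖ` sentence is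
`∃ C ∈ {0,1}^{q(n)} ∀ i, i₁, …, iₖ ∈ {0,1}^{p(n)} T(x, C(i), C(i₁), …, C(iₖ)) = 1` "where `T` is
some polynomial-time TM checking these conditions". Here the circuit `C` is replaced by an
**advice string** `W` for a polynomial-time advice language `A` (the tree's
`P/poly = P/poly-advice`, `PPoly_subset_polyAdvice_P`, `CircuitEval.lean`), queried on the words of
the row language `Tableau.RowLang M` (`TableauRows.lean`):

* `Meyer.qry M Q R x t J v = ⟨x, ⟨natBits Q t, ⟨natBits R J, codeVal v⟩⟩⟩` — "is block `J` of row
  `t` equal to `v`?", row and block indices written in fixed widths `Q`, `R`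
  (`StackUnaryBits.natBits`); `Meyer.ans` — the advice's answer bit `[⟨qry, W⟩ ∈ A]`;
  `Meyer.rho` — **the rows claimed by the advice**: the first block value (in the enumeration
  `Tableau.allVals`) answered `yes`, `noneVal` if none (`Meyer.decodeBits`); a truthful advice
  claims the true rows (`Meyer.rho_eq_of_ans`).
* The **polynomial-time matrix** reads its input `u = ⟨⟨x, W⟩, ⟨T', J₀'⟩⟩` (instance, advice, and
  the universally quantified *descriptor*: a row index `T'` of width `Q` and a block index `J₀'` of
  width `R`) through `FP` string functions assembled from the tree's bricks — pair projections
  (`fstP`/`sndP`), unary rulers `1^{p(n)}` (`Plumb.polyFn`), fixed-width numerals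
  (`Brick.padTakeFn`, `takeD_eq_natBits`), sums (`Brick.addFn`) and the indicator of `A`
  (`indicatorFn_mem_FP`): `Meyer.rowFn`/`Meyer.colFn` write the row/block indices of the `7d + 6`
  blocks a local check at `(t, J₀)` mentions (`Meyer.blockSpec`: blocks `0 … 3d` of row `t`,
  `0 … 2d` of row `t + 1`, `J₀ … J₀ + 2d` of row `t`, `J₀ + d` of row `t + 1`, `J₀` of row `0`,
  `1` of row `T = 2^q`), `Meyer.blockFn` collects the answer bits of one block for all values and
  `Meyer.answersFn` those of all blocks (`Meyer.answersFn_apply`, `Meyer.answersFn_mem_FP`).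

The flags, the evidence word, the judge and the matrix language are in `MeyerMatrix.lean`; the
`Σ₂ᵖ` sentence in `MeyerSigmaTwo.lean`.

Parameters: two polynomials `qP`, `hP`; at input length `n` the time bound is `T = 2^{q}`,
`q = qP(n)`, row indices have width `Q = q + 1`, the emptiness threshold is `H = 2^{h}`,
`h = hP(n)`, block indices have width `R = h + 1` (`S = 2^R` blocks per row).

## References

* S. Arora, B. Barak, *Computational Complexity: A Modern Approach*, CUP 2009, Thm. 6.20 (proof
  sketch, p. 114), Thm. 6.18 (`P/poly` as advice), §1.3.
* R. M. Karp, R. J. Lipton, *Some connections between nonuniform and uniform complexity classes*,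
  Proc. 12th STOC (1980) 302–309, §6.
-/

namespace Literature.Computability.Complexity

namespace Meyer

open _root_.Computability Turing Polynomial Tableau Brick Plumb

variable (M : TM2ComputableAux Bool Bool)

/-! ### Queries, answers, the claimed rows -/

section Oracle

/-- **The query** "is block `J` of row `t` of the run on `x` equal to `v`?": the word
`⟨x, ⟨natBits Q t, ⟨natBits R J, codeVal v⟩⟩⟩` of the row language (`Tableau.RowLang`), indices in
fixed widths `Q`, `R`. [cite: AroraBarakCC2009, Thm. 6.20 (proof)] -/
noncomputable def qry (Q R : ℕ) (x : List Bool) (t J : ℕ) (v : Val M.tm) : List Bool :=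
  boolPair x (boolPair (natBits Q t) (boolPair (natBits R J) (codeVal M.tm v)))

/-- The length of a query depends only on `|x|`, `Q`, `R`. [folklore] -/
theorem length_qry (Q R : ℕ) (x : List Bool) (t J : ℕ) (v : Val M.tm) :
    (qry M Q R x t J v).length = 2 * x.length + 2 + (2 * Q + 2 + (2 * R + 2 + Nat.card (Val M.tm))) := by
  simp [qry]

/-- A query of in-range indices is in the row language iff `v` is the true block.
[cite: AroraBarakCC2009, Thm. 6.20 (proof)] -/
theorem qry_mem_rowLang_iff {Q R : ℕ} (x : List Bool) {t J : ℕ} (ht : t < 2 ^ Q) (hJ : J < 2 ^ R)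
    (v : Val M.tm) : qry M Q R x t J v ∈ RowLang M ↔ v = absVal (rowCfg M x t) J := by
  rw [qry, boolPair_mem_rowLang_iff, bitsToNat_natBits ht, bitsToNat_natBits hJ,
    (codeVal_injective M.tm).eq_iff]

/-- **The advice's answer** to a query: the bit `[⟨qry, W⟩ ∈ A]` for the advice language `A` and
the advice string `W`. [cite: AroraBarakCC2009, Thm. 6.20 (proof)] -/
noncomputable def ans (A : Language Bool) (W : List Bool) (Q R : ℕ) (x : List Bool) (t J : ℕ)
    (v : Val M.tm) : Bool :=
  A.boolIndicator (boolPair (qry M Q R x t J v) W)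

/-- Decoding one block of answer bits (one bit per value, in the order of `allVals`): the first
value answered `yes`, `noneVal` if there is none. [folklore] -/
noncomputable def decodeBits (bits : List Bool) : Val M.tm :=
  (((allVals M).zip bits).find? fun p => p.2).elim (noneVal M.tm) Prod.fst

/-- **The rows claimed by the advice**: `rho … t J` is the block value decoded from the answers to
the queries `(t, J, v)`, `v` ranging over all values (Arora–Barak 2009, proof of Thm. 6.20: "the
transcript implicitly computed by this circuit"). [cite: AroraBarakCC2009, Thm. 6.20 (proof)] -/
noncomputable def rho (A : Language Bool) (W : List Bool) (Q R : ℕ) (x : List Bool) (t J : ℕ) :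
    Val M.tm :=
  decodeBits M ((allVals M).map (ans M A W Q R x t J))

variable {M}

/-- Zipping a list with its own image. [folklore] -/
theorem zip_map_self {α β : Type} (f : α → β) : ∀ l : List α, l.zip (l.map f) = l.map fun a => (a, f a)
  | [] => rfl
  | a :: l => by rw [List.map_cons, List.zip_cons_cons, List.map_cons, zip_map_self f l]

/-- Decoding the indicator bits of a single value gives that value. [folklore] -/
theorem decodeBits_map_eq {f : Val M.tm → Bool} {v₀ : Val M.tm} (hf : ∀ v, f v = true ↔ v = v₀) :
    decodeBits M ((allVals M).map f) = v₀ := by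
  unfold decodeBits
  rw [zip_map_self, List.find?_map]
  have hp : ((fun p : Val M.tm × Bool => p.2) ∘ fun v => (v, f v)) = f := funext fun _ => rfl
  rw [hp]
  cases h : (allVals M).find? f with
  | none => exact absurd ((hf v₀).2 rfl) ((List.find?_eq_none.1 h) v₀ (mem_allVals M v₀))
  | some a =>
    have ha : a = v₀ := (hf a).1 (List.find?_some h)
    subst ha
    rfl

/-- **A truthful advice claims the true rows**: if every query `(t, J, v)` is answered `yes`
exactly when `v = v₀`, then `rho … t J = v₀`. [cite: AroraBarakCC2009, Thm. 6.20 (proof)] -/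
theorem rho_eq_of_ans {A : Language Bool} {W : List Bool} {Q R : ℕ} {x : List Bool} {t J : ℕ}
    {v₀ : Val M.tm} (h : ∀ v, ans M A W Q R x t J v = true ↔ v = v₀) :
    rho M A W Q R x t J = v₀ :=
  decodeBits_map_eq h

end Oracle

/-! ### Reading the matrix input `u = ⟨⟨x, W⟩, ⟨T', J₀'⟩⟩` -/

section Access

/-- `u ↦ x`, the instance. [folklore] -/
def instU : List Bool → List Bool := fstP ∘ fstP

/-- `u ↦ W`, the advice. [folklore] -/
def advU : List Bool → List Bool := sndP ∘ fstP

/-- `u ↦ T'`, the row index of the descriptor. [folklore] -/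
def rowU : List Bool → List Bool := fstP ∘ sndP

/-- `u ↦ J₀'`, the block index of the descriptor. [folklore] -/
def colU : List Bool → List Bool := sndP ∘ sndP

variable (x W T' J' : List Bool)

/-- Value of `instU`. [folklore] -/
@[simp] theorem instU_apply : instU (boolPair (boolPair x W) (boolPair T' J')) = x := by simp [instU]

/-- Value of `advU`. [folklore] -/
@[simp] theorem advU_apply : advU (boolPair (boolPair x W) (boolPair T' J')) = W := by simp [advU]

/-- Value of `rowU`. [folklore] -/
@[simp] theorem rowU_apply : rowU (boolPair (boolPair x W) (boolPair T' J')) = T' := by simp [rowU]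

/-- Value of `colU`. [folklore] -/
@[simp] theorem colU_apply : colU (boolPair (boolPair x W) (boolPair T' J')) = J' := by simp [colU]

/-- `instU ∈ FP`. [folklore] -/
theorem instU_mem_FP : instU ∈ FP := comp_mem_FP fstP_mem_FP fstP_mem_FP

/-- `advU ∈ FP`. [folklore] -/
theorem advU_mem_FP : advU ∈ FP := comp_mem_FP sndP_mem_FP fstP_mem_FP

/-- `rowU ∈ FP`. [folklore] -/
theorem rowU_mem_FP : rowU ∈ FP := comp_mem_FP fstP_mem_FP sndP_mem_FP

/-- `colU ∈ FP`. [folklore] -/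
theorem colU_mem_FP : colU ∈ FP := comp_mem_FP sndP_mem_FP sndP_mem_FP

/-- The unary ruler `1^{p(|x|)}` of a polynomial `p`. [folklore] -/
noncomputable def ruler (p : Polynomial ℕ) : List Bool → List Bool := polyFn p ∘ instU

/-- Value of a ruler. [folklore] -/
@[simp] theorem ruler_apply (p : Polynomial ℕ) :
    ruler p (boolPair (boolPair x W) (boolPair T' J')) = ones (p.eval x.length) := by
  simp [ruler]

/-- Rulers are in `FP`. [folklore] -/
theorem ruler_mem_FP (p : Polynomial ℕ) : ruler p ∈ FP := comp_mem_FP (polyFn_mem_FP p) instU_mem_FP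

/-- **Fixed-width numerals**: `fixW p f u = natBits (p |x|) ⟦f u⟧`, the value of the numeral `f u`
written in exactly `p(|x|)` bits (`padTakeFn` against the ruler; `takeD_eq_natBits`). [folklore] -/
noncomputable def fixW (p : Polynomial ℕ) (f : List Bool → List Bool) : List Bool → List Bool :=
  fstP ∘ padTakeFn ∘ pairFn (ruler p) f

/-- Value of `fixW`. [folklore] -/
theorem fixW_apply (p : Polynomial ℕ) (f : List Bool → List Bool) :
    fixW p f (boolPair (boolPair x W) (boolPair T' J')) =
      natBits (p.eval x.length) (bitsToNat (f (boolPair (boolPair x W) (boolPair T' J')))) := by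
  simp [fixW, takeD_eq_natBits]

/-- `fixW p f ∈ FP` for `f ∈ FP`. [folklore] -/
theorem fixW_mem_FP (p : Polynomial ℕ) {f : List Bool → List Bool} (hf : f ∈ FP) : fixW p f ∈ FP :=
  comp_mem_FP fstP_mem_FP (comp_mem_FP padTakeFn_mem_FP (pairFn_mem_FP (ruler_mem_FP p) hf))

/-- `natBits (m + 1) (2^m) = 0^m 1`. [folklore] -/
theorem natBits_two_pow (m : ℕ) : natBits (m + 1) (2 ^ m) = natBits m 0 ++ [true] := by
  have h : List.takeD (m + 1) (List.replicate m false ++ [true]) false = natBits (m + 1) (2 ^ m) := by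
    rw [takeD_eq_natBits, bitsToNat_append, bitsToNat_replicate_false, List.length_replicate]
    simp
  rw [← h, CoinEnum.natBits_zero, List.takeD_eq_take, List.take_of_length_le] <;> simp

/-- The numeral `2^{p(|x|)}` in `p(|x|) + 1` bits: `fixW p ε ++ [1]`. [folklore] -/
noncomputable def pow2Fn (p : Polynomial ℕ) (u : List Bool) : List Bool :=
  fixW p (fun _ => []) u ++ [true]

/-- Value of `pow2Fn`: the width-`p(|x|) + 1` representation of `2^{p(|x|)}`. [folklore] -/
theorem pow2Fn_apply (p : Polynomial ℕ) :
    pow2Fn p (boolPair (boolPair x W) (boolPair T' J')) = natBits (p.eval x.length + 1) (2 ^ p.eval x.length) := by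
  rw [pow2Fn, fixW_apply, natBits_two_pow, bitsToNat_nil]

/-- The value of `pow2Fn` as a number. [folklore] -/
theorem bitsToNat_pow2Fn (p : Polynomial ℕ) :
    bitsToNat (pow2Fn p (boolPair (boolPair x W) (boolPair T' J'))) = 2 ^ p.eval x.length := by
  rw [pow2Fn_apply, bitsToNat_natBits (Nat.pow_lt_pow_right (by norm_num) (Nat.lt_succ_self _))]

/-- `pow2Fn p ∈ FP`. [folklore] -/
theorem pow2Fn_mem_FP (p : Polynomial ℕ) : pow2Fn p ∈ FP :=
  append_mem_FP (fixW_mem_FP p (const_mem_FP [])) (const_mem_FP [true])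

end Access

/-! ### Row and block indices of the blocks a local check mentions -/

section Blocks

/-- Which row a block refers to: the descriptor's row `t`, the next row `t + 1`, row `0`, or the
last row `T = 2^q`. [cite: AroraBarakCC2009, Thm. 6.20 (proof)] -/
inductive RowSpec
  | cur
  | next
  | zero
  | last

/-- Which block index a block refers to: a constant `s`, or the descriptor's `J₀` offset by `s`.
[cite: AroraBarakCC2009, Thm. 6.20 (proof)] -/
inductive ColSpec
  | const (s : ℕ)
  | off (s : ℕ)

/-- The row index meant by a `RowSpec`, given `q` and the descriptor's `t`. [folklore] -/
def rowVal (q t : ℕ) : RowSpec → ℕ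
  | .cur => t
  | .next => t + 1
  | .zero => 0
  | .last => 2 ^ q

/-- The block index meant by a `ColSpec`, given the descriptor's `J₀`. [folklore] -/
def colVal (J₀ : ℕ) : ColSpec → ℕ
  | .const s => s
  | .off s => J₀ + s

variable (qP hP : Polynomial ℕ)

/-- The `FP` function writing the row index of a `RowSpec` in width `Q = qP(|x|) + 1`. [folklore] -/
noncomputable def rowFn : RowSpec → List Bool → List Bool
  | .cur => rowU
  | .next => fixW (qP + 1) (addFn ∘ pairFn rowU fun _ => encodeNat 1)
  | .zero => fixW (qP + 1) fun _ => []
  | .last => pow2Fn qP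

/-- The `FP` function writing the block index of a `ColSpec` in width `R = hP(|x|) + 1`. [folklore] -/
noncomputable def colFn : ColSpec → List Bool → List Bool
  | .const s => fixW (hP + 1) fun _ => encodeNat s
  | .off s => fixW (hP + 1) (addFn ∘ pairFn colU fun _ => encodeNat s)

variable {qP hP}
variable (x W T' J' : List Bool)

/-- **Value of `rowFn`** on a descriptor whose row index has the right width `Q`. [folklore] -/
theorem rowFn_apply (hT : T'.length = qP.eval x.length + 1) (rs : RowSpec) :
    rowFn qP rs (boolPair (boolPair x W) (boolPair T' J')) =
      natBits (qP.eval x.length + 1) (rowVal (qP.eval x.length) (bitsToNat T') rs) := by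
  cases rs with
  | cur => simpa [rowFn, rowVal] using CoinEnum.eq_natBits_of_length hT
  | next => simp [rowFn, rowVal, fixW_apply]
  | zero => simp [rowFn, rowVal, fixW_apply]
  | last => simp [rowFn, rowVal, pow2Fn_apply]

/-- **Value of `colFn`**. [folklore] -/
theorem colFn_apply (cs : ColSpec) :
    colFn hP cs (boolPair (boolPair x W) (boolPair T' J')) =
      natBits (hP.eval x.length + 1) (colVal (bitsToNat J') cs) := by
  cases cs with
  | const s => simp [colFn, colVal, fixW_apply]
  | off s => simp [colFn, colVal, fixW_apply]

variable (qP hP)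

/-- `rowFn qP rs ∈ FP`. [folklore] -/
theorem rowFn_mem_FP (rs : RowSpec) : rowFn qP rs ∈ FP := by
  cases rs with
  | cur => exact rowU_mem_FP
  | next => exact fixW_mem_FP _ (comp_mem_FP addFn_mem_FP (pairFn_mem_FP rowU_mem_FP (const_mem_FP _)))
  | zero => exact fixW_mem_FP _ (const_mem_FP _)
  | last => exact pow2Fn_mem_FP _

/-- `colFn hP cs ∈ FP`. [folklore] -/
theorem colFn_mem_FP (cs : ColSpec) : colFn hP cs ∈ FP := by
  cases cs with
  | const s => exact fixW_mem_FP _ (const_mem_FP _)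
  | off s => exact fixW_mem_FP _ (comp_mem_FP addFn_mem_FP (pairFn_mem_FP colU_mem_FP (const_mem_FP _)))

/-- The number of blocks a local check at `(t, J₀)` mentions: `7d + 6`. [folklore] -/
def nBlocks (d : ℕ) : ℕ := 7 * d + 6

/-- **The blocks of a local check** at the descriptor `(t, J₀)`, numbered `i < 7d + 6`:
blocks `0 … 3d` of row `t` (indices `0 … 3d`), blocks `0 … 2d` of row `t + 1`
(`3d + 1 … 5d + 1`), blocks `J₀ … J₀ + 2d` of row `t` (`5d + 2 … 7d + 2`), block `J₀ + d` of row
`t + 1` (`7d + 3`), block `J₀` of row `0` (`7d + 4`), block `1` of row `2^q` (`7d + 5`)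
(Arora–Barak 2009, proof of Thm. 6.20: the snapshots `zᵢ, z_{i₁}, …, z_{iₖ}` a local criterion
mentions). [cite: AroraBarakCC2009, Thm. 6.20 (proof)] -/
def blockSpec (d i : ℕ) : RowSpec × ColSpec :=
  if i < 3 * d + 1 then (.cur, .const i)
  else if i < 5 * d + 2 then (.next, .const (i - (3 * d + 1)))
  else if i < 7 * d + 3 then (.cur, .off (i - (5 * d + 2)))
  else if i = 7 * d + 3 then (.next, .off d)
  else if i = 7 * d + 4 then (.zero, .off 0)
  else (.last, .const 1)

/-- The query word of a block with claimed value `v`, as an `FP` function of `u`. [folklore] -/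
noncomputable def qryFn (row col : List Bool → List Bool) (v : Val M.tm) : List Bool → List Bool :=
  pairFn instU (pairFn row (pairFn col fun _ => codeVal M.tm v))

/-- The answer bit of the advice to the query of a block with claimed value `v`, as an `FP`
function of `u` (one-symbol output `encodeBool`). [cite: AroraBarakCC2009, Thm. 6.20 (proof)] -/
noncomputable def ansFn (A : Language Bool) (row col : List Bool → List Bool) (v : Val M.tm) :
    List Bool → List Bool :=
  (fun w => encodeBool (A.boolIndicator w)) ∘ pairFn (qryFn M row col v) advU

/-- The answer bits of one block, one per value in the order of `allVals`. [folklore] -/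
noncomputable def blockFn (A : Language Bool) (row col : List Bool → List Bool) : List Bool → List Bool :=
  flattenFn ((allVals M).map (ansFn M A row col))

/-- **The answer bits of all blocks of a local check.** [cite: AroraBarakCC2009, Thm. 6.20 (proof)] -/
noncomputable def answersFn (A : Language Bool) (d : ℕ) : List Bool → List Bool :=
  flattenFn ((List.range (nBlocks d)).map fun i =>
    blockFn M A (rowFn qP (blockSpec d i).1) (colFn hP (blockSpec d i).2))

variable {M qP hP}

/-- `flattenFn` of one-symbol functions is the list of the symbols. [folklore] -/
theorem flattenFn_map_singleton {α : Type} (l : List α) (g : α → List Bool → Bool) (u : List Bool) :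
    flattenFn (l.map fun a w => [g a w]) u = l.map fun a => g a u := by
  induction l with
  | nil => rfl
  | cons a l ih => rw [List.map_cons, flattenFn_cons, ih]; rfl

/-- **Value of `blockFn`**: if `row`/`col` write `natBits Q t` / `natBits R J`, the block's bits are
the advice's answers `ans … t J v`, `v ∈ allVals`. [folklore] -/
theorem blockFn_apply {A : Language Bool} {row col : List Bool → List Bool} {Q R t J : ℕ}
    (hrow : row (boolPair (boolPair x W) (boolPair T' J')) = natBits Q t)
    (hcol : col (boolPair (boolPair x W) (boolPair T' J')) = natBits R J) :
    blockFn M A row col (boolPair (boolPair x W) (boolPair T' J')) =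
      (allVals M).map (ans M A W Q R x t J) := by
  have h : (allVals M).map (ansFn M A row col) =
      (allVals M).map fun v w => [A.boolIndicator (pairFn (qryFn M row col v) advU w)] := by
    refine List.map_congr_left fun v _ => funext fun w => ?_
    rfl
  rw [blockFn, h, flattenFn_map_singleton]
  refine List.map_congr_left fun v _ => ?_
  simp [qryFn, ans, qry, hrow, hcol]

/-- **Value of `answersFn`**: the concatenation over the blocks `i < 7d + 6` of the answer bits of
block `i`, read at the row/block indices `rowVal`/`colVal` of `blockSpec d i`. [folklore] -/
theorem answersFn_apply {A : Language Bool} {d : ℕ} (hT : T'.length = qP.eval x.length + 1) :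
    answersFn M qP hP A d (boolPair (boolPair x W) (boolPair T' J')) =
      ((List.range (nBlocks d)).map fun i => (allVals M).map
        (ans M A W (qP.eval x.length + 1) (hP.eval x.length + 1) x
          (rowVal (qP.eval x.length) (bitsToNat T') (blockSpec d i).1)
          (colVal (bitsToNat J') (blockSpec d i).2))).flatten := by
  rw [answersFn, flattenFn, List.map_map]
  congr 1
  refine List.map_congr_left fun i _ => ?_
  exact blockFn_apply x W T' J' (rowFn_apply x W T' J' hT _) (colFn_apply x W T' J' _)

variable (M qP hP)

/-- `blockFn … ∈ FP` for `A ∈ P` and `row`, `col ∈ FP`. [folklore] -/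
theorem blockFn_mem_FP {A : Language Bool} (hA : A ∈ Classes.P) {row col : List Bool → List Bool}
    (hrow : row ∈ FP) (hcol : col ∈ FP) : blockFn M A row col ∈ FP := by
  refine flattenFn_mem_FP fun f hf => ?_
  rw [List.mem_map] at hf
  obtain ⟨v, -, rfl⟩ := hf
  exact comp_mem_FP (indicatorFn_mem_FP hA) (pairFn_mem_FP
    (pairFn_mem_FP instU_mem_FP (pairFn_mem_FP hrow (pairFn_mem_FP hcol (const_mem_FP _)))) advU_mem_FP)

/-- **`answersFn … ∈ FP`** for `A ∈ P`. [cite: AroraBarakCC2009, Thm. 6.20 (proof)] -/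
theorem answersFn_mem_FP {A : Language Bool} (hA : A ∈ Classes.P) (d : ℕ) :
    answersFn M qP hP A d ∈ FP := by
  refine flattenFn_mem_FP fun f hf => ?_
  rw [List.mem_map] at hf
  obtain ⟨i, -, rfl⟩ := hf
  exact blockFn_mem_FP M hA (rowFn_mem_FP qP _) (colFn_mem_FP hP _)

end Blocks

end Meyer

end Literature.Computability.Complexity
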